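import Summits.QuantumFields.BalabanUV.Beta.GAN24.TransverseFluxReflection
import Summits.QuantumFields.BalabanUV.Beta.GAN24.BiStencilZeroMode

/-!
# `BalabanUV.Beta.GAN24.ResponseResidueClassSums` — binder row G-an2-4 ∕ (CONV-C), the (S) row ∕ (W-γ) one level up:
# **BLOCK-WEIGHTED SUMS OF A RESPONSE COLUMN OVER A NON-CROSSING CONTOUR POSITION VANISH; HENCE EVERY BLOCK-WEIGHTED SUM OF ITS END-INSIDE AND BASE-OUTSIDE
# PARTIAL CONTOUR SUMS VANISHES** — `Σ'_w g(w_μ)·EI_{Lc}(colH G_j Lc l t) μ w = 0 = Σ'_w g(w_μ)·BO_{Lc}(colH G_j Lc l t) μ w` (`Lc` odd, centred root, every `j l t μ`, bounded `g`)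
# (G-an2-4 CRUX TEAM (2), seat `b2b-balaban-gan24-formalise-leaf-06` = the (γ) hand, gen 49, FILE (δ1))

NOT IN PRINT; OUR BOOKKEEPING ([folklore] BY NAME: leaf-06 g48 FILE F `ResponseColumnSlabFlux.tsum_coordWeight_mul_colH` (same-direction flux profile: exit slice only), TODAY's FILE (γ)
`TransverseFluxReflection.tsum_coordWeight_mul_colH_transverse` (transverse flux ≡ 0), leaf-02's block decomposition `BiStencilZeroMode.tsum_eq_sum_box_tsum`, `KKTFluctuationEnergy.tsum_shift`,
an2's `SecondOrderSplitDecay.summable_colH_mul_bdd`; 0 `def`, 0 cited fact, 0 `def … : Prop`, 0 sorry).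
HONEST FRAMING (cell contract, verbatim): «discharging `BetaPertH` makes Bałaban's UV stability UNCONDITIONAL — a real constructive-QFT result; it is NOT the continuum limit and NOT
the Clay problem.»  HONEST DEPENDENCY (verbatim): «continuum YM on T⁴ ⇐ BetaPertH ∧ nine spine estimates (0/9 proved); BetaPertH ⇐ (D1) ∧ (D4) ∧ CAP+tail; G-an2-4 gates asym,
D1 and NE2/3/4.»

WHY (R1 [GAN24LEAF06-G49-R1], memo `HOME/b2b-balaban-gan24-formalise-leaf-06/g49/E30-E31-CENSUS.md` §(C)).  The one defect the closed form of `X_1` rests on, `(C2′) =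
⟨C_0 h, dψ⊙(BO − EI)(H_0 n)⟩`, reduces (E3 + periodicity of `n`) to FACE SUMS of `U = (BO − EI)(H_0 n)`, and — after unfolding `H_0 n = Σ_{(l,t)} n(l,t)·colH G_0(l,t)` and periodising the
data index — to sums of `EI ∕ BO` of a SINGLE response column over a residue class of blocks `{w : w_μ ≡ r}`.  This file proves that every such sum vanishes, for every bounded weight
`g(w_μ)` on the block index: a contour position `c = b_μ + s ≠ Lc − 1` of the `μ`-contours reads the column on the fine bonds `u` with `u_μ ≡ c (mod Lc)` — never the exit slice — so
the fine sum is a single-coordinate-weighted column sum, `= 𝟙[l = μ]·cH_j·Lc^d·(weight at the exit slice) = 0` by FILE F when the datum is parallel (`l = μ`) and `= 0` by the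
transverse flux lemma when it is not.  `EI` collects the positions `c ≤ Lc − 2`, `BO` the positions `Lc ≤ c ≤ 2Lc − 2`; the crossing position `c = Lc − 1` (FILE (α)'s `Qx`) is the
only one a response column sees.
* §1 `emod_eq_zero_iff_of_lt`, **`sum_filter_box_tsum_blockWeight_shift`** — the lattice bookkeeping: for summable `F`, bounded `g`, `b₀ < N`, any `s`:
  `Σ_{b∈box, b_μ = b₀} Σ'_w g(w_μ)·F(N•w + b + s•e_μ) = Σ'_u W(u_μ)·F u` with the single-coordinate weight `W(S) = [N ∣ S − c]·g((S − c)/N)`, `c = b₀ + s`.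
* §2 **`sum_filter_box_tsum_blockWeight_colH_eq_zero`** — `Σ_{b∈box, b_μ=b₀} Σ'_w g(w_μ)·colH G_j Lc l t μ (Lc•w + b + s•e_μ) = 0` whenever `b₀ + s ≠ Lc − 1` (`Lc` odd, centred root,
  every `j l t μ`, `b₀, s < Lc` or `s < Lc` with `Lc ≤ b₀ + s`).
* §3 **`tsum_blockWeight_mul_EI_colH_eq_zero`**, **`tsum_blockWeight_mul_BO_colH_eq_zero`** — the block-weighted sums of FILE (α)'s `EI_{Lc}` and `BO_{Lc}` of every response column vanish;
  `tsum_residueInd_mul_BOsubEI_colH_eq_zero` (`g = 𝟙_{· % Lc = r}`: the residue-class sums of `(BO − EI)(colH G_j(l,t))` — the periodised face sums of R1 §(C)).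
Asserts NO value of any resolvent column beyond FILE F + FILE (γ); (C2′) itself (the E3 ∕ periodicity ∕ face bookkeeping) is NOT here; NOTHING of (W-γ) at levels ≥ 1 ∕ (S) discharged;
NEVER «G-an2-4 closed» as (CONV-C); NOT D1, NOT `BetaPertH`, NOT continuum, NOT Clay.  2026-08-23; no existing file touched.
-/

noncomputable section

open Finset
open scoped BigOperators
open Literature.MathematicalPhysics.QuantumFieldTheory
open Literature.MathematicalPhysics.QuantumFieldTheory.Balaban1983to89
open Literature.MathematicalPhysics.QuantumFieldTheory.Balaban1983to89.Beta
open ExpKernelCalculus (Site MKer Decays)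
open AffineAveraging (box toSite unitVec unitVec_apply)
open AveragingContoursRooted (ctrOff ctrOff_mem_box)
open OneStepKernelFamily (KInvStep colH)
open KKTFluctuationEnergy (tsum_shift)
open Summit.QuantumFields.BalabanUV.Beta.AxialDressingRooted (coDressKBmAt decays_coDressKBmAt_KInvStep one_le_of_neZero)
open Summit.QuantumFields.BalabanUV.Beta.BorderedHessian (stepScale)
open Summit.QuantumFields.BalabanUV.Beta.SecondOrderSplitDecay (summable_colH_mul_bdd)
open Summit.QuantumFields.BalabanUV.Beta.GAN24.BiStencilZeroMode (tsum_eq_sum_box_tsum)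
open Summit.QuantumFields.BalabanUV.Beta.GAN24.ResponseColumnSlabFlux (tsum_coordWeight_mul_colH)
open Summit.QuantumFields.BalabanUV.Beta.GAN24.TransverseFluxReflection (tsum_coordWeight_mul_colH_transverse)

namespace Summit.QuantumFields.BalabanUV.Beta.GAN24.ResponseResidueClassSums

variable {d : ℕ}

/-! ## §1 Lattice bookkeeping: a block weight on one contour position is a single-coordinate weight on the fine lattice -/

/-- [folklore] For `|z| < N`: `z % N = 0 ↔ z = 0`. -/
theorem emod_eq_zero_iff_of_lt {N : ℕ} {z : ℤ} (h1 : -(N : ℤ) < z) (h2 : z < N) : z % (N : ℤ) = 0 ↔ z = 0 := by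
  constructor
  · intro h
    obtain ⟨k, hk⟩ := Int.dvd_of_emod_eq_zero h
    rcases lt_trichotomy k 0 with hk0 | hk0 | hk0
    · nlinarith
    · rw [hk, hk0, mul_zero]
    · nlinarith
  · intro h; rw [h, Int.zero_emod]

/-- [folklore] **A BLOCK WEIGHT ON ONE CONTOUR POSITION IS A SINGLE-COORDINATE WEIGHT** (`N ≥ 1`, `b₀ < N`, any `s`, summable `F`, bounded `g`):
`Σ_{b∈box, b_μ = b₀} Σ'_w g(w_μ)·F(N•w + b + s•e_μ) = Σ'_u W(u_μ)·F u`, `W(S) = [N ∣ S − (b₀+s)]·g((S − (b₀+s))/N)` — the fine points of the `s`-th bonds of the `μ`-contours from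
the box points with `μ`-offset `b₀`, over all blocks, are exactly the fine points `u` with `u_μ ≡ b₀ + s (mod N)`, each once, with block index `(u_μ − b₀ − s)/N`. -/
theorem sum_filter_box_tsum_blockWeight_shift {N : ℕ} [NeZero N] (μ : Fin (d + 1)) {b₀ : ℕ} (hb₀ : b₀ < N) (s : ℕ) (g : ℤ → ℝ) {B : ℝ} (hg : ∀ z, |g z| ≤ B)
    {F : Site (d + 1) → ℝ} (hF : Summable F) :
    ∑ b ∈ (box (d + 1) N).filter (fun b => b μ = b₀), ∑' w : Site (d + 1), g (w μ) * F ((N : ℤ) • w + toSite b + (s : ℤ) • unitVec μ)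
      = ∑' u : Site (d + 1), (if (u μ - ((b₀ + s : ℕ) : ℤ)) % (N : ℤ) = 0 then g ((u μ - ((b₀ + s : ℕ) : ℤ)) / (N : ℤ)) else 0) * F u := by
  classical
  have hN : (0 : ℤ) < N := by exact_mod_cast Nat.pos_of_ne_zero (NeZero.ne N)
  have hB : 0 ≤ B := (abs_nonneg _).trans (hg 0)
  set W : ℤ → ℝ := fun S => if (S - ((b₀ + s : ℕ) : ℤ)) % (N : ℤ) = 0 then g ((S - ((b₀ + s : ℕ) : ℤ)) / (N : ℤ)) else 0 with hW
  have hWb : ∀ S, |W S| ≤ B := fun S => by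
    simp only [hW]; split_ifs
    · exact hg _
    · rw [abs_zero]; exact hB
  -- the weighted function is summable, and so is its shift by `s•e_μ`
  have hWF : Summable fun u : Site (d + 1) => W (u μ) * F u :=
    Summable.of_norm_bounded (hF.abs.mul_left B) fun u => by
      rw [Real.norm_eq_abs, abs_mul]; exact mul_le_mul (hWb _) le_rfl (abs_nonneg _) hB
  have hWFs : Summable fun u : Site (d + 1) => W ((u + (s : ℤ) • unitVec μ) μ) * F (u + (s : ℤ) • unitVec μ) :=
    (Equiv.addRight ((s : ℤ) • unitVec μ)).summable_iff.2 hWF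
  -- shift, then block decomposition
  rw [show (∑' u : Site (d + 1), W (u μ) * F u) = ∑' u : Site (d + 1), W ((u + (s : ℤ) • unitVec μ) μ) * F (u + (s : ℤ) • unitVec μ) from
    (tsum_shift (fun u => W (u μ) * F u) ((s : ℤ) • unitVec μ)).symm]
  rw [tsum_eq_sum_box_tsum (N := N) hWFs]
  -- per box point: the weight selects `b_μ = b₀` and returns `g(w_μ)`
  have hbox : ∀ b ∈ box (d + 1) N, b μ < N := fun b hb => Finset.mem_range.1 (Fintype.mem_piFinset.1 hb μ)
  have hval : ∀ b ∈ box (d + 1) N, ∀ w : Site (d + 1),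
      W (((N : ℤ) • w + toSite b + (s : ℤ) • unitVec μ) μ) = if b μ = b₀ then g (w μ) else 0 := by
    intro b hb w
    have e1 : ((N : ℤ) • w + toSite b + (s : ℤ) • unitVec μ) μ - ((b₀ + s : ℕ) : ℤ) = ((b μ : ℤ) - (b₀ : ℤ)) + (N : ℤ) * w μ := by
      simp only [Pi.add_apply, Pi.smul_apply, smul_eq_mul, AffineAveraging.toSite, unitVec_apply, if_true, mul_one]
      push_cast; ring
    simp only [hW, e1]
    have hlt1 : -(N : ℤ) < (b μ : ℤ) - (b₀ : ℤ) := by have := hbox b hb; omega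
    have hlt2 : (b μ : ℤ) - (b₀ : ℤ) < N := by have := hbox b hb; omega
    rw [Int.add_mul_emod_self_left]
    by_cases hbb : b μ = b₀
    · have hz : (b μ : ℤ) - (b₀ : ℤ) = 0 := by rw [hbb]; ring
      rw [if_pos (by rw [hz, Int.zero_emod]), if_pos hbb, hz, zero_add, Int.mul_ediv_cancel_left _ (ne_of_gt hN)]
    · have hz : ¬ ((b μ : ℤ) - (b₀ : ℤ) = 0) := fun h => hbb (by exact_mod_cast (sub_eq_zero.1 h))
      rw [if_neg (fun h => hz ((emod_eq_zero_iff_of_lt hlt1 hlt2).1 h)), if_neg hbb]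
  rw [Finset.sum_filter]
  refine Finset.sum_congr rfl fun b hb => ?_
  by_cases hbb : b μ = b₀
  · rw [if_pos hbb]
    refine tsum_congr fun w => ?_
    rw [hval b hb w, if_pos hbb]
  · rw [if_neg hbb]
    have hz : (fun w : Site (d + 1) => W (((N : ℤ) • w + toSite b + (s : ℤ) • unitVec μ) μ) * F ((N : ℤ) • w + toSite b + (s : ℤ) • unitVec μ)) = fun _ => 0 := by
      funext w; rw [hval b hb w, if_neg hbb, zero_mul]
    rw [show (fun w : Site (d + 1) => W (((N : ℤ) • w + toSite b + (s : ℤ) • unitVec μ) μ) * F ((N : ℤ) • w + toSite b + (s : ℤ) • unitVec μ))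
        = fun w => W ((((N : ℤ) • w + toSite b) + (s : ℤ) • unitVec μ) μ) * F (((N : ℤ) • w + toSite b) + (s : ℤ) • unitVec μ) from rfl] at hz
    rw [hz, tsum_zero]

/-! ## §2 Response columns: every non-crossing contour position reads zero -/

section Columns

variable {Lc : ℕ} [NeZero Lc]

/-- NOT IN PRINT; OUR BOOKKEEPING.  **A RESPONSE COLUMN READS ZERO ON EVERY NON-CROSSING CONTOUR POSITION** (`Lc` odd, centred root, every level `j`, every datum `(l, t)`, every contour
direction `μ`, every bounded block weight `g`; `b₀ < Lc`, `b₀ + s ≠ Lc − 1`, `b₀ + s < 2Lc − 1`):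
`Σ_{b∈box, b_μ=b₀} Σ'_w g(w_μ)·colH G_j Lc l t μ (Lc•w + b + s•e_μ) = 0` — by §1 a single-coordinate weight supported off the exit slices, killed by FILE F (`l = μ`) or the transverse
flux lemma (`l ≠ μ`). -/
theorem sum_filter_box_tsum_blockWeight_colH_eq_zero (hLc : Odd Lc) (j : ℕ) (l μ : Fin (d + 1)) (t : Site (d + 1)) (g : ℤ → ℝ) {B : ℝ} (hg : ∀ z, |g z| ≤ B)
    {b₀ s : ℕ} (hb₀ : b₀ < Lc) (hc : b₀ + s ≠ Lc - 1) (hc2 : b₀ + s < 2 * Lc - 1) :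
    ∑ b ∈ (box (d + 1) Lc).filter (fun b => b μ = b₀), ∑' w : Site (d + 1),
        g (w μ) * colH (coDressKBmAt (toSite (ctrOff (d + 1) Lc)) Lc (KInvStep (d := d) Lc j)) Lc l t μ ((Lc : ℤ) • w + toSite b + (s : ℤ) • unitVec μ) = 0 := by
  classical
  have hLc1 : 1 ≤ Lc := one_le_of_neZero Lc
  have hr := ctrOff_mem_box (d := d + 1) hLc1
  obtain ⟨δG, CG, hδG, hCG, hG⟩ := decays_coDressKBmAt_KInvStep (d := d) hr j
  have hF : Summable fun u : Site (d + 1) => colH (coDressKBmAt (toSite (ctrOff (d + 1) Lc)) Lc (KInvStep (d := d) Lc j)) Lc l t μ u :=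
    (summable_colH_mul_bdd (N := Lc) ⟨δG, CG, hδG, hCG, hG⟩ (T := fun _ => (1 : ℝ)) (B := 1) (fun _ => by simp) l t μ).congr fun u => by simp
  rw [sum_filter_box_tsum_blockWeight_shift μ hb₀ s g hg hF]
  -- the single-coordinate weight
  set W : ℤ → ℝ := fun S => if (S - ((b₀ + s : ℕ) : ℤ)) % (Lc : ℤ) = 0 then g ((S - ((b₀ + s : ℕ) : ℤ)) / (Lc : ℤ)) else 0 with hW
  have hB : 0 ≤ B := (abs_nonneg _).trans (hg 0)
  have hWb : ∀ S, |W S| ≤ B := fun S => by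
    simp only [hW]; split_ifs
    · exact hg _
    · rw [abs_zero]; exact hB
  by_cases hl : l = μ
  · subst hl
    rw [tsum_coordWeight_mul_colH hr j l W hWb t l, if_pos rfl]
    -- the weight vanishes at the exit slice: `Lc·t_l + Lc − 1 − (b₀+s) ≡ −(b₀+s+1) ≢ 0`
    have hz : W ((Lc : ℤ) * t l + (Lc : ℤ) - 1) = 0 := by
      simp only [hW]
      rw [if_neg]
      intro h
      have e : (Lc : ℤ) * t l + (Lc : ℤ) - 1 - ((b₀ + s : ℕ) : ℤ) = (-(((b₀ + s : ℕ) : ℤ) + 1)) + (Lc : ℤ) * (t l + 1) := by push_cast; ring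
      rw [e, Int.add_mul_emod_self_left] at h
      -- `-(c+1) % Lc = 0` with `0 < c + 1 < 2Lc`, `c + 1 ≠ Lc`
      have h1 : ((Lc : ℤ)) ∣ (((b₀ + s : ℕ) : ℤ) + 1) := by
        have := Int.dvd_of_emod_eq_zero h
        rwa [Int.dvd_neg] at this
      obtain ⟨k, hk⟩ := h1
      have hpos : (0 : ℤ) < ((b₀ + s : ℕ) : ℤ) + 1 := by positivity
      have hlt : ((b₀ + s : ℕ) : ℤ) + 1 < 2 * (Lc : ℤ) := by
        have : b₀ + s + 1 < 2 * Lc := by omega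
        exact_mod_cast (by omega : ((b₀ + s : ℕ) : ℤ) + 1 < 2 * (Lc : ℤ))
      have hL : (0 : ℤ) < Lc := by exact_mod_cast hLc1
      have hk1 : k = 1 := by
        rcases lt_trichotomy k 1 with hk0 | hk0 | hk0
        · nlinarith
        · exact hk0
        · nlinarith
      rw [hk1, mul_one] at hk
      apply hc
      have : b₀ + s + 1 = Lc := by exact_mod_cast hk
      omega
    rw [hz, mul_zero]
  · exact tsum_coordWeight_mul_colH_transverse hLc j (μ' := l) (μ := μ) (κ := μ) (fun h => hl h.symm) (fun h => hl h.symm) W hWb t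

end Columns

/-! ## §3 The block-weighted sums of the partial contour sums of a response column vanish -/

section Partial

variable {Lc : ℕ} [NeZero Lc]

/-- [folklore] Regrouping a box sum by the `μ`-th offset. -/
theorem sum_box_eq_sum_range_sum_filter {N : ℕ} (μ : Fin (d + 1)) (h : (Fin (d + 1) → ℕ) → ℝ) :
    ∑ b ∈ box (d + 1) N, h b = ∑ b₀ ∈ Finset.range N, ∑ b ∈ (box (d + 1) N).filter (fun b => b μ = b₀), h b := by
  classical
  rw [← Finset.sum_fiberwise_of_maps_to (s := box (d + 1) N) (t := Finset.range N) (g := fun b => b μ)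
    (fun b hb => Finset.mem_range.2 (Finset.mem_range.1 (Fintype.mem_piFinset.1 hb μ)))]

/-- NOT IN PRINT; OUR BOOKKEEPING.  **EVERY BLOCK-WEIGHTED SUM OF THE END-INSIDE PARTIAL CONTOUR SUM OF A RESPONSE COLUMN VANISHES** (`Lc` odd, centred root, every `j l t μ`,
bounded `g`): `Σ'_w g(w_μ)·EI_{Lc}(colH G_j Lc l t) μ w = 0`, `EI_{Lc} v μ w = Σ_{b∈box} Σ_{s<Lc} [b_μ+s+1 < Lc]·v μ (Lc•w + b + s•e_μ)` (FILE (α)'s letters). -/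
theorem tsum_blockWeight_mul_EI_colH_eq_zero (hLc : Odd Lc) (j : ℕ) (l μ : Fin (d + 1)) (t : Site (d + 1)) (g : ℤ → ℝ) {B : ℝ} (hg : ∀ z, |g z| ≤ B) :
    ∑' w : Site (d + 1), g (w μ) * ∑ b ∈ box (d + 1) Lc, ∑ s ∈ Finset.range Lc,
        (if b μ + s + 1 < Lc then colH (coDressKBmAt (toSite (ctrOff (d + 1) Lc)) Lc (KInvStep (d := d) Lc j)) Lc l t μ ((Lc : ℤ) • w + toSite b + (s : ℤ) • unitVec μ) else 0) = 0 := by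
  classical
  have hLc1 : 1 ≤ Lc := one_le_of_neZero Lc
  obtain ⟨δG, CG, hδG, hCG, hG⟩ := decays_coDressKBmAt_KInvStep (d := d) (ctrOff_mem_box (d := d + 1) hLc1) j
  -- summability of each shifted weighted column
  have hsum : ∀ (b : Fin (d + 1) → ℕ) (s : ℕ), Summable fun w : Site (d + 1) => g (w μ) * colH (coDressKBmAt (toSite (ctrOff (d + 1) Lc)) Lc (KInvStep (d := d) Lc j)) Lc l t μ ((Lc : ℤ) • w + toSite b + (s : ℤ) • unitVec μ) := by
    intro b s
    have h1 : Summable fun u : Site (d + 1) => g ((u μ - (b μ : ℤ) - (s : ℤ)) / (Lc : ℤ)) * colH (coDressKBmAt (toSite (ctrOff (d + 1) Lc)) Lc (KInvStep (d := d) Lc j)) Lc l t μ u :=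
      (summable_colH_mul_bdd (N := Lc) ⟨δG, CG, hδG, hCG, hG⟩ (T := fun u => g ((u μ - (b μ : ℤ) - (s : ℤ)) / (Lc : ℤ))) (fun u => hg _) l t μ).congr
        fun u => by simp [mul_comm]
    have hinj : Function.Injective fun w : Site (d + 1) => (Lc : ℤ) • w + toSite b + (s : ℤ) • unitVec μ := by
      intro w w' h
      have h' : (Lc : ℤ) • w = (Lc : ℤ) • w' := by
        have := congrArg (fun z => z - toSite b - (s : ℤ) • unitVec μ) h
        simpa using this
      funext i
      have := congrFun h' i
      simp only [Pi.smul_apply, smul_eq_mul] at this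
      exact mul_left_cancel₀ (by exact_mod_cast (NeZero.ne Lc)) this
    have h2 := h1.comp_injective hinj
    refine h2.congr fun w => ?_
    simp only [Function.comp, Pi.add_apply, Pi.smul_apply, smul_eq_mul, AffineAveraging.toSite, unitVec_apply, if_true, mul_one]
    congr 2
    have hL : (Lc : ℤ) ≠ 0 := by exact_mod_cast NeZero.ne Lc
    have e : (Lc : ℤ) * w μ + (b μ : ℤ) + (s : ℤ) - (b μ : ℤ) - (s : ℤ) = (Lc : ℤ) * w μ := by ring
    rw [e, Int.mul_ediv_cancel_left _ hL]
  -- pull the finite sums out of the series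
  have e1 : (fun w : Site (d + 1) => g (w μ) * ∑ b ∈ box (d + 1) Lc, ∑ s ∈ Finset.range Lc,
        (if b μ + s + 1 < Lc then colH (coDressKBmAt (toSite (ctrOff (d + 1) Lc)) Lc (KInvStep (d := d) Lc j)) Lc l t μ ((Lc : ℤ) • w + toSite b + (s : ℤ) • unitVec μ) else 0))
      = fun w => ∑ b ∈ box (d + 1) Lc, ∑ s ∈ Finset.range Lc,
          (if b μ + s + 1 < Lc then g (w μ) * colH (coDressKBmAt (toSite (ctrOff (d + 1) Lc)) Lc (KInvStep (d := d) Lc j)) Lc l t μ ((Lc : ℤ) • w + toSite b + (s : ℤ) • unitVec μ) else 0) := by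
    funext w
    rw [Finset.mul_sum]
    refine Finset.sum_congr rfl fun b _ => ?_
    rw [Finset.mul_sum]
    refine Finset.sum_congr rfl fun s _ => ?_
    split_ifs <;> simp
  have hsum' : ∀ (b : Fin (d + 1) → ℕ) (s : ℕ), Summable fun w : Site (d + 1) =>
      (if b μ + s + 1 < Lc then g (w μ) * colH (coDressKBmAt (toSite (ctrOff (d + 1) Lc)) Lc (KInvStep (d := d) Lc j)) Lc l t μ ((Lc : ℤ) • w + toSite b + (s : ℤ) • unitVec μ) else 0) := by
    intro b s
    by_cases h : b μ + s + 1 < Lc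
    · simp only [if_pos h]; exact hsum b s
    · simp only [if_neg h]; exact summable_zero
  rw [e1, Summable.tsum_finsetSum (fun b _ => summable_sum fun s _ => hsum' b s)]
  simp only [Summable.tsum_finsetSum (fun s _ => hsum' _ s)]
  -- regroup the box by the `μ`-offset and kill each non-crossing position
  rw [Finset.sum_comm, Finset.sum_eq_zero]
  intro s hs
  have hsL : s < Lc := Finset.mem_range.1 hs
  rw [sum_box_eq_sum_range_sum_filter μ, Finset.sum_eq_zero]
  intro b₀ hb₀
  have hb₀L : b₀ < Lc := Finset.mem_range.1 hb₀
  by_cases hpos : b₀ + s + 1 < Lc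
  · have e2 : ∀ b ∈ (box (d + 1) Lc).filter (fun b => b μ = b₀),
        (∑' w : Site (d + 1), (if b μ + s + 1 < Lc then g (w μ) * colH (coDressKBmAt (toSite (ctrOff (d + 1) Lc)) Lc (KInvStep (d := d) Lc j)) Lc l t μ ((Lc : ℤ) • w + toSite b + (s : ℤ) • unitVec μ) else 0))
          = ∑' w : Site (d + 1), g (w μ) * colH (coDressKBmAt (toSite (ctrOff (d + 1) Lc)) Lc (KInvStep (d := d) Lc j)) Lc l t μ ((Lc : ℤ) • w + toSite b + (s : ℤ) • unitVec μ) := by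
      intro b hb
      have hbμ : b μ = b₀ := (Finset.mem_filter.1 hb).2
      exact tsum_congr fun w => by rw [if_pos (by rw [hbμ]; exact hpos)]
    rw [Finset.sum_congr rfl e2]
    exact sum_filter_box_tsum_blockWeight_colH_eq_zero hLc j l μ t g hg hb₀L (by omega) (by omega)
  · refine Finset.sum_eq_zero fun b hb => ?_
    have hbμ : b μ = b₀ := (Finset.mem_filter.1 hb).2
    have hz : (fun w : Site (d + 1) => (if b μ + s + 1 < Lc then g (w μ) * colH (coDressKBmAt (toSite (ctrOff (d + 1) Lc)) Lc (KInvStep (d := d) Lc j)) Lc l t μ ((Lc : ℤ) • w + toSite b + (s : ℤ) • unitVec μ) else 0)) = fun _ => 0 := by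
      funext w; rw [if_neg (by rw [hbμ]; exact hpos)]
    rw [hz, tsum_zero]

/-- NOT IN PRINT; OUR BOOKKEEPING.  **EVERY BLOCK-WEIGHTED SUM OF THE BASE-OUTSIDE PARTIAL CONTOUR SUM OF A RESPONSE COLUMN VANISHES**: `Σ'_w g(w_μ)·BO_{Lc}(colH G_j Lc l t) μ w = 0`,
`BO_{Lc} v μ w = Σ_{b∈box} Σ_{s<Lc} [Lc ≤ b_μ+s]·v μ (Lc•w + b + s•e_μ)` (the positions `Lc ≤ b_μ + s ≤ 2Lc − 2` are never the crossing one). -/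
theorem tsum_blockWeight_mul_BO_colH_eq_zero (hLc : Odd Lc) (j : ℕ) (l μ : Fin (d + 1)) (t : Site (d + 1)) (g : ℤ → ℝ) {B : ℝ} (hg : ∀ z, |g z| ≤ B) :
    ∑' w : Site (d + 1), g (w μ) * ∑ b ∈ box (d + 1) Lc, ∑ s ∈ Finset.range Lc,
        (if Lc ≤ b μ + s then colH (coDressKBmAt (toSite (ctrOff (d + 1) Lc)) Lc (KInvStep (d := d) Lc j)) Lc l t μ ((Lc : ℤ) • w + toSite b + (s : ℤ) • unitVec μ) else 0) = 0 := by
  classical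
  have hLc1 : 1 ≤ Lc := one_le_of_neZero Lc
  obtain ⟨δG, CG, hδG, hCG, hG⟩ := decays_coDressKBmAt_KInvStep (d := d) (ctrOff_mem_box (d := d + 1) hLc1) j
  have hsum : ∀ (b : Fin (d + 1) → ℕ) (s : ℕ), Summable fun w : Site (d + 1) => g (w μ) * colH (coDressKBmAt (toSite (ctrOff (d + 1) Lc)) Lc (KInvStep (d := d) Lc j)) Lc l t μ ((Lc : ℤ) • w + toSite b + (s : ℤ) • unitVec μ) := by
    intro b s
    have h1 : Summable fun u : Site (d + 1) => g ((u μ - (b μ : ℤ) - (s : ℤ)) / (Lc : ℤ)) * colH (coDressKBmAt (toSite (ctrOff (d + 1) Lc)) Lc (KInvStep (d := d) Lc j)) Lc l t μ u :=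
      (summable_colH_mul_bdd (N := Lc) ⟨δG, CG, hδG, hCG, hG⟩ (T := fun u => g ((u μ - (b μ : ℤ) - (s : ℤ)) / (Lc : ℤ))) (fun u => hg _) l t μ).congr
        fun u => by simp [mul_comm]
    have hinj : Function.Injective fun w : Site (d + 1) => (Lc : ℤ) • w + toSite b + (s : ℤ) • unitVec μ := by
      intro w w' h
      have h' : (Lc : ℤ) • w = (Lc : ℤ) • w' := by
        have := congrArg (fun z => z - toSite b - (s : ℤ) • unitVec μ) h
        simpa using this
      funext i
      have := congrFun h' i
      simp only [Pi.smul_apply, smul_eq_mul] at this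
      exact mul_left_cancel₀ (by exact_mod_cast (NeZero.ne Lc)) this
    have h2 := h1.comp_injective hinj
    refine h2.congr fun w => ?_
    simp only [Function.comp, Pi.add_apply, Pi.smul_apply, smul_eq_mul, AffineAveraging.toSite, unitVec_apply, if_true, mul_one]
    congr 2
    have hL : (Lc : ℤ) ≠ 0 := by exact_mod_cast NeZero.ne Lc
    have e : (Lc : ℤ) * w μ + (b μ : ℤ) + (s : ℤ) - (b μ : ℤ) - (s : ℤ) = (Lc : ℤ) * w μ := by ring
    rw [e, Int.mul_ediv_cancel_left _ hL]
  have e1 : (fun w : Site (d + 1) => g (w μ) * ∑ b ∈ box (d + 1) Lc, ∑ s ∈ Finset.range Lc,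
        (if Lc ≤ b μ + s then colH (coDressKBmAt (toSite (ctrOff (d + 1) Lc)) Lc (KInvStep (d := d) Lc j)) Lc l t μ ((Lc : ℤ) • w + toSite b + (s : ℤ) • unitVec μ) else 0))
      = fun w => ∑ b ∈ box (d + 1) Lc, ∑ s ∈ Finset.range Lc,
          (if Lc ≤ b μ + s then g (w μ) * colH (coDressKBmAt (toSite (ctrOff (d + 1) Lc)) Lc (KInvStep (d := d) Lc j)) Lc l t μ ((Lc : ℤ) • w + toSite b + (s : ℤ) • unitVec μ) else 0) := by
    funext w
    rw [Finset.mul_sum]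
    refine Finset.sum_congr rfl fun b _ => ?_
    rw [Finset.mul_sum]
    refine Finset.sum_congr rfl fun s _ => ?_
    split_ifs <;> simp
  have hsum' : ∀ (b : Fin (d + 1) → ℕ) (s : ℕ), Summable fun w : Site (d + 1) =>
      (if Lc ≤ b μ + s then g (w μ) * colH (coDressKBmAt (toSite (ctrOff (d + 1) Lc)) Lc (KInvStep (d := d) Lc j)) Lc l t μ ((Lc : ℤ) • w + toSite b + (s : ℤ) • unitVec μ) else 0) := by
    intro b s
    by_cases h : Lc ≤ b μ + s
    · simp only [if_pos h]; exact hsum b s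
    · simp only [if_neg h]; exact summable_zero
  rw [e1, Summable.tsum_finsetSum (fun b _ => summable_sum fun s _ => hsum' b s)]
  simp only [Summable.tsum_finsetSum (fun s _ => hsum' _ s)]
  rw [Finset.sum_comm, Finset.sum_eq_zero]
  intro s hs
  have hsL : s < Lc := Finset.mem_range.1 hs
  rw [sum_box_eq_sum_range_sum_filter μ, Finset.sum_eq_zero]
  intro b₀ hb₀
  have hb₀L : b₀ < Lc := Finset.mem_range.1 hb₀
  by_cases hpos : Lc ≤ b₀ + s
  · have e2 : ∀ b ∈ (box (d + 1) Lc).filter (fun b => b μ = b₀),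
        (∑' w : Site (d + 1), (if Lc ≤ b μ + s then g (w μ) * colH (coDressKBmAt (toSite (ctrOff (d + 1) Lc)) Lc (KInvStep (d := d) Lc j)) Lc l t μ ((Lc : ℤ) • w + toSite b + (s : ℤ) • unitVec μ) else 0))
          = ∑' w : Site (d + 1), g (w μ) * colH (coDressKBmAt (toSite (ctrOff (d + 1) Lc)) Lc (KInvStep (d := d) Lc j)) Lc l t μ ((Lc : ℤ) • w + toSite b + (s : ℤ) • unitVec μ) := by
      intro b hb
      have hbμ : b μ = b₀ := (Finset.mem_filter.1 hb).2
      exact tsum_congr fun w => by rw [if_pos (by rw [hbμ]; exact hpos)]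
    rw [Finset.sum_congr rfl e2]
    exact sum_filter_box_tsum_blockWeight_colH_eq_zero hLc j l μ t g hg hb₀L (by omega) (by omega)
  · refine Finset.sum_eq_zero fun b hb => ?_
    have hbμ : b μ = b₀ := (Finset.mem_filter.1 hb).2
    have hz : (fun w : Site (d + 1) => (if Lc ≤ b μ + s then g (w μ) * colH (coDressKBmAt (toSite (ctrOff (d + 1) Lc)) Lc (KInvStep (d := d) Lc j)) Lc l t μ ((Lc : ℤ) • w + toSite b + (s : ℤ) • unitVec μ) else 0)) = fun _ => 0 := by
      funext w; rw [if_neg (by rw [hbμ]; exact hpos)]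
    rw [hz, tsum_zero]

end Partial

end Summit.QuantumFields.BalabanUV.Beta.GAN24.ResponseResidueClassSums

end
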